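import Literature.NumberTheory.NumberFields.RayClassFieldLocalTowerDisjoint
import HarnessLib

/-!
# GLOBAL NORMS ARE LOCAL NORMS along `ι : K̄ → K̄_v`:
# `ι(N_{K(𝔪v^{m+1})/K(𝔪v^{n+1})} x) = N_{E·K_π^{m+1}/E·K_π^{n+1}}(ι x)` — de Shalit II.1.10 / II.4.5 / III.1.2 (2) at the split prime

Sequel of `RayClassFieldLocalTowerDisjoint.lean` (same setting: `K` totally complex, `𝔪 ≠ 0`, `v ∤ 𝔪`, `w_𝔪 = 1`,
a uniformiser `π` of `K_v`, `α ∈ 𝓞_K` with `α ≡ 1 mod 𝔪`, `(α) = 𝔭_v^f`, `α = π^f` in `K_v` — the ABSOLUTE Lubin–Tate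
model — and a finite Galois `E ≤ K_v^{nr}` with `f ∣ deg w` for every Weil element fixing `E`).  There: (INJ) an element
of `Γ_{K_v}` fixing `E` and `ι(K(𝔪v^{m+1}))` fixes `E·K_π^{m+1}`; (SURJ) every `ρ ∈ Gal(K(𝔪v^{m+1})/K(𝔪v^{n+1}))` is
the restriction of a local inertia element fixing `E·K_π^{n+1}`.  HERE:

* §1 ★ `absClosureEmbedding_towerNorm_eq_towerNorm` — PURE GALOIS THEORY: for `L₀ ≤ L ⊆ K̄`, `M₀ ≤ M ⊆ K̄_v` finite
  Galois with `ι(L) ⊆ M`, `ι(L₀) ⊆ M₀`, (INJ) and (SURJ) ⟹ `ι(N_{L/L₀} x) = N_{M/M₀}(ι x)` (both `Algebra.norm` for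
  the tower algebras `towerAlgebra`; both are products over the relative Galois groups — `algebraMap_towerNorm_eq_prod`
  — which the restriction `σ ↦ (res σ̃)|_L` of a normal lift `σ̃` identifies, `Finset.prod_bij`);
* §2 ★★ `absClosureEmbedding_towerNorm_rayClassField_mul_pow_eq` — **THE NORM COMPATIBILITY** for the ray class
  tower `K(𝔪v^{n+1}) ≤ K(𝔪v^{m+1})` and the local tower `E·K_π^{n+1} ≤ E·K_π^{m+1}`, `n ≤ m`.

So a norm-coherent sequence of GLOBAL units `x_m ∈ K(𝔪v^{m+1})` (elliptic units, de Shalit II.2.5) is, under `ι`,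
norm-coherent along `E·K_π^{m+1}`: an element of the tree's `RelNormCoherentUnits hπ E` — the units input `β_m(𝔞)` of
brick B5 of the measure side of de Shalit II.4.  Theorems only; no `sorry`.

## References
* [deShalit1987] E. de Shalit, *Iwasawa theory of elliptic curves with complex multiplication* (1987), II.1.9 (p. 43),
  II.1.10 Lemma and Corollary (p. 39), II.4.5 (12)–(13) (p. 58), III.1.2 (2) (p. 101).
* [NeukirchANT1999] J. Neukirch, *Algebraic Number Theory* (1999), Ch. VI §5 Prop. (5.6), Ch. IV §1 (1.2).
-/

noncomputable section

open NumberField IsDedekindDomain IsDedekindDomain.HeightOneSpectrum Field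
open scoped nonZeroDivisors Classical

namespace Literature.NumberTheory.NumberFields

open Literature.NumberTheory.GaloisRepresentations
open Literature.NumberTheory.GaloisRepresentations.ArtinLocalGlobal
open Literature.NumberTheory.GaloisRepresentations.IsNonarchimedeanLocalField

variable {K : Type} [Field K] [NumberField K] {𝔪 : Ideal (𝓞 K)} {v : HeightOneSpectrum (𝓞 K)}

omit [NumberField K] in
/-- `((τ|_L) x : K̄) = τ • x`. [folklore] -/
private theorem coe_absRestrictNormalHom_apply₁₁ (L : IntermediateField K (AlgebraicClosure K)) [Normal K L]
    (τ : absoluteGaloisGroup K) (x : L) :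
    ((absRestrictNormalHom L τ x : L) : AlgebraicClosure K) = τ • (x : AlgebraicClosure K) :=
  AlgEquiv.restrictNormalHom_apply L _ x

/-! ### §1. The restriction map on finite levels; norms along `ι` (pure Galois theory) -/

/-- `K(𝔪v^{n+1}) ≤ K(𝔪v^{m+1})` for `n ≤ m`. [cite: deShalit1987, II.1.9 (p. 43)] -/
theorem rayClassField_mul_pow_succ_mono (h𝔪 : 𝔪 ≠ ⊥) (v : HeightOneSpectrum (𝓞 K)) {n m : ℕ} (hnm : n ≤ m) :
    rayClassField K (𝔪 * v.asIdeal ^ (n + 1)) ≤ rayClassField K (𝔪 * v.asIdeal ^ (m + 1)) :=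
  rayClassField_le_of_le (mul_ne_zero h𝔪 (pow_ne_zero _ v.ne_bot))
    (Ideal.mul_mono_right (Ideal.pow_le_pow_right (by omega)))

/-- **The restriction `σ ↦ (res σ̃)|_L` computed on elements**: for a normal `M ⊆ K̄_v`, `σ ∈ Aut_{K_v}(M)` with normal
lift `σ̃ ∈ Γ_{K_v}`, a normal `L ⊆ K̄` and `x ∈ L` with `ι x ∈ M`: `ι(((res σ̃)|_L x)) = σ ⟨ι x⟩`.
[cite: NeukirchANT1999, Ch. IV §1 (1.2)] -/
theorem absClosureEmbedding_absRestrictNormalHom_absGaloisRestrict_liftNormal_apply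
    (L : IntermediateField K (AlgebraicClosure K)) [Normal K L]
    (M : IntermediateField (v.adicCompletion K) (AlgebraicClosure (v.adicCompletion K))) [Normal (v.adicCompletion K) M]
    (σ : M ≃ₐ[v.adicCompletion K] M) (x : L)
    (hx : absClosureEmbedding K (v.adicCompletion K) x ∈ M) :
    absClosureEmbedding K (v.adicCompletion K)
        ((absRestrictNormalHom L (absGaloisRestrict K (v.adicCompletion K)
          ((absoluteGaloisGroup.toAlgEquiv (v.adicCompletion K)).symm
            (σ.liftNormal (AlgebraicClosure (v.adicCompletion K))))) x : L) : AlgebraicClosure K) =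
      ((σ ⟨absClosureEmbedding K (v.adicCompletion K) x, hx⟩ : M) : AlgebraicClosure (v.adicCompletion K)) := by
  rw [coe_absRestrictNormalHom_apply₁₁, absGaloisRestrict_apply_smul, absoluteGaloisGroup.toAlgEquiv_symm_apply]
  have h := σ.liftNormal_commutes (AlgebraicClosure (v.adicCompletion K)) ⟨absClosureEmbedding K (v.adicCompletion K) x, hx⟩
  rwa [IntermediateField.algebraMap_apply, IntermediateField.algebraMap_apply] at h

/-- The normal lift `σ̃` of `σ ∈ Aut_{K_v}(M)` acts on `M` through `σ`: `σ̃ • z = σ z`. [cite: NeukirchANT1999, Ch. IV §1 (1.2)] -/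
theorem toAlgEquiv_symm_liftNormal_smul_coe
    (M : IntermediateField (v.adicCompletion K) (AlgebraicClosure (v.adicCompletion K))) [Normal (v.adicCompletion K) M]
    (σ : M ≃ₐ[v.adicCompletion K] M) (z : M) :
    (absoluteGaloisGroup.toAlgEquiv (v.adicCompletion K)).symm (σ.liftNormal (AlgebraicClosure (v.adicCompletion K))) •
        ((z : M) : AlgebraicClosure (v.adicCompletion K)) = ((σ z : M) : AlgebraicClosure (v.adicCompletion K)) := by
  rw [absoluteGaloisGroup.toAlgEquiv_symm_apply]
  have h := σ.liftNormal_commutes (AlgebraicClosure (v.adicCompletion K)) z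
  rwa [IntermediateField.algebraMap_apply, IntermediateField.algebraMap_apply] at h

/-- ★ **Norms along `ι` match whenever the relative Galois groups match** (pure Galois theory): let `L₀ ≤ L ⊆ K̄` (`L/K`
finite Galois) and `M₀ ≤ M ⊆ K̄_v` (`M/K_v` finite Galois) with `ι(L) ⊆ M`, `ι(L₀) ⊆ M₀`; assume (INJ) every `τ ∈ Γ_{K_v}`
fixing `M₀` and `ι(L)` pointwise fixes `M`, and (SURJ) every `ρ ∈ Gal(L/K)` fixing `L₀` is `(res τ)|_L` for some `τ ∈ Γ_{K_v}`
fixing `M₀`.  Then `ι(N_{L/L₀} x) = N_{M/M₀}(ι x)` for all `x ∈ L` (`Algebra.norm` for the tower algebras; both are products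
over the relative groups, which `σ ↦ (res σ̃)|_L` identifies). [cite: deShalit1987, II.4.5 (p. 58), III.1.2 (2) (p. 101)] -/
theorem absClosureEmbedding_towerNorm_eq_towerNorm
    (L₀ L : IntermediateField K (AlgebraicClosure K)) [FiniteDimensional K L] [IsGalois K L] (hL : L₀ ≤ L)
    (M₀ M : IntermediateField (v.adicCompletion K) (AlgebraicClosure (v.adicCompletion K)))
    [FiniteDimensional (v.adicCompletion K) M] [IsGalois (v.adicCompletion K) M] (hM : M₀ ≤ M)
    (hιL : ∀ y : AlgebraicClosure K, y ∈ L → absClosureEmbedding K (v.adicCompletion K) y ∈ M)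
    (hιL₀ : ∀ y : AlgebraicClosure K, y ∈ L₀ → absClosureEmbedding K (v.adicCompletion K) y ∈ M₀)
    (hinj : ∀ τ : absoluteGaloisGroup (v.adicCompletion K), τ ∈ M₀.fixingSubgroup →
      (∀ y ∈ L, τ • absClosureEmbedding K (v.adicCompletion K) y = absClosureEmbedding K (v.adicCompletion K) y) →
        τ ∈ M.fixingSubgroup)
    (hsurj : ∀ ρ : L ≃ₐ[K] L, (∀ y : L, (y : AlgebraicClosure K) ∈ L₀ → ((ρ y : L) : AlgebraicClosure K) = y) →
      ∃ τ : absoluteGaloisGroup (v.adicCompletion K),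
        absRestrictNormalHom L (absGaloisRestrict K (v.adicCompletion K) τ) = ρ ∧ τ ∈ M₀.fixingSubgroup)
    (x : L) :
    absClosureEmbedding K (v.adicCompletion K)
        ((@Algebra.norm L₀ L _ _ (towerAlgebra hL) x : L₀) : AlgebraicClosure K) =
      ((@Algebra.norm M₀ M _ _ (towerAlgebra hM) ⟨absClosureEmbedding K (v.adicCompletion K) x, hιL x x.2⟩ : M₀) :
        AlgebraicClosure (v.adicCompletion K)) := by
  haveI hMn : Normal (v.adicCompletion K) M := IsGalois.to_normal
  haveI hLn : Normal K L := IsGalois.to_normal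
  -- the restriction map `r` and its defining identity
  have hr : ∀ (σ : M ≃ₐ[v.adicCompletion K] M) (y : L),
      absClosureEmbedding K (v.adicCompletion K) ((absRestrictNormalHom L (absGaloisRestrict K (v.adicCompletion K)
        ((absoluteGaloisGroup.toAlgEquiv (v.adicCompletion K)).symm
          (σ.liftNormal (AlgebraicClosure (v.adicCompletion K))))) y : L) : AlgebraicClosure K) =
        ((σ ⟨absClosureEmbedding K (v.adicCompletion K) y, hιL y y.2⟩ : M) : AlgebraicClosure (v.adicCompletion K)) :=
    fun σ y ↦ absClosureEmbedding_absRestrictNormalHom_absGaloisRestrict_liftNormal_apply L M σ y (hιL y y.2)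
  -- both norms as products over the relative groups, pushed into the algebraic closures
  have eL : (((@Algebra.norm L₀ L _ _ (towerAlgebra hL) x : L₀) : AlgebraicClosure K)) =
      ∏ ρ ∈ Finset.univ.filter (fun ρ : L ≃ₐ[K] L ↦
        ∀ y : L₀, ρ (IntermediateField.inclusion hL y) = IntermediateField.inclusion hL y),
        ((ρ x : L) : AlgebraicClosure K) := by
    have h := congrArg (fun z : L ↦ (z : AlgebraicClosure K)) (algebraMap_towerNorm_eq_prod (F := K) hL x)
    simp only [IntermediateField.coe_inclusion] at h
    rw [h, ← IntermediateField.coe_val, map_prod]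
  have eM : ((@Algebra.norm M₀ M _ _ (towerAlgebra hM) ⟨absClosureEmbedding K (v.adicCompletion K) x, hιL x x.2⟩ : M₀) :
      AlgebraicClosure (v.adicCompletion K)) =
      ∏ σ ∈ Finset.univ.filter (fun σ : M ≃ₐ[v.adicCompletion K] M ↦
        ∀ y : M₀, σ (IntermediateField.inclusion hM y) = IntermediateField.inclusion hM y),
        ((σ ⟨absClosureEmbedding K (v.adicCompletion K) x, hιL x x.2⟩ : M) : AlgebraicClosure (v.adicCompletion K)) := by
    have h := congrArg (fun z : M ↦ (z : AlgebraicClosure (v.adicCompletion K)))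
      (algebraMap_towerNorm_eq_prod (F := v.adicCompletion K) hM ⟨absClosureEmbedding K (v.adicCompletion K) x, hιL x x.2⟩)
    simp only [IntermediateField.coe_inclusion] at h
    rw [h, ← IntermediateField.coe_val, map_prod]
  rw [eL, eM, map_prod]
  symm
  -- the normal lifts fix `M₀` pointwise when `σ` does
  have hfix₀ : ∀ (σ : M ≃ₐ[v.adicCompletion K] M),
      (∀ y : M₀, σ (IntermediateField.inclusion hM y) = IntermediateField.inclusion hM y) →
      ∀ z : AlgebraicClosure (v.adicCompletion K), z ∈ M₀ →
        (absoluteGaloisGroup.toAlgEquiv (v.adicCompletion K)).symm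
          (σ.liftNormal (AlgebraicClosure (v.adicCompletion K))) • z = z := by
    intro σ hσ z hz
    have h := toAlgEquiv_symm_liftNormal_smul_coe M σ (IntermediateField.inclusion hM ⟨z, hz⟩)
    rw [hσ ⟨z, hz⟩, IntermediateField.coe_inclusion] at h
    exact h
  -- reindex along `r`
  refine Finset.prod_bij (fun σ _ ↦ absRestrictNormalHom L (absGaloisRestrict K (v.adicCompletion K)
      ((absoluteGaloisGroup.toAlgEquiv (v.adicCompletion K)).symm
        (σ.liftNormal (AlgebraicClosure (v.adicCompletion K))))))
    (fun σ hσ ↦ ?_) (fun σ₁ hσ₁ σ₂ hσ₂ h12 ↦ ?_) (fun ρ hρ ↦ ?_) (fun σ _ ↦ (hr σ x).symm)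
  · -- `r σ` fixes `L₀`
    rw [Finset.mem_filter] at hσ ⊢
    refine ⟨Finset.mem_univ _, fun y ↦ Subtype.ext ((absClosureEmbedding K (v.adicCompletion K)).injective ?_)⟩
    have e1 : (⟨absClosureEmbedding K (v.adicCompletion K) ((IntermediateField.inclusion hL y : L) : AlgebraicClosure K),
        hιL _ (IntermediateField.inclusion hL y).2⟩ : M) =
        IntermediateField.inclusion hM ⟨absClosureEmbedding K (v.adicCompletion K) y, hιL₀ y y.2⟩ :=
      Subtype.ext rfl
    have h : absClosureEmbedding K (v.adicCompletion K) ((absRestrictNormalHom L (absGaloisRestrict K (v.adicCompletion K)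
        ((absoluteGaloisGroup.toAlgEquiv (v.adicCompletion K)).symm
          (σ.liftNormal (AlgebraicClosure (v.adicCompletion K))))) (IntermediateField.inclusion hL y) : L) :
            AlgebraicClosure K) =
        absClosureEmbedding K (v.adicCompletion K) ((IntermediateField.inclusion hL y : L) : AlgebraicClosure K) := by
      rw [hr σ, e1, hσ.2, IntermediateField.coe_inclusion, IntermediateField.coe_inclusion]
    exact h
  · -- injectivity: `σ̃₂⁻¹ σ̃₁` fixes `M₀` and `ι(L)`, hence `M`
    rw [Finset.mem_filter] at hσ₁ hσ₂
    have hτ₀ : ((absoluteGaloisGroup.toAlgEquiv (v.adicCompletion K)).symm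
        (σ₂.liftNormal (AlgebraicClosure (v.adicCompletion K))))⁻¹ *
        (absoluteGaloisGroup.toAlgEquiv (v.adicCompletion K)).symm
          (σ₁.liftNormal (AlgebraicClosure (v.adicCompletion K))) ∈ M₀.fixingSubgroup := by
      refine (IntermediateField.mem_fixingSubgroup_iff _ _).mpr fun z hz ↦ ?_
      change (((absoluteGaloisGroup.toAlgEquiv (v.adicCompletion K)).symm
        (σ₂.liftNormal (AlgebraicClosure (v.adicCompletion K))))⁻¹ *
        (absoluteGaloisGroup.toAlgEquiv (v.adicCompletion K)).symm
          (σ₁.liftNormal (AlgebraicClosure (v.adicCompletion K)))) • z = z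
      rw [mul_smul, hfix₀ σ₁ hσ₁.2 z hz, inv_smul_eq_iff, hfix₀ σ₂ hσ₂.2 z hz]
    have hτfix : ∀ y ∈ L, (((absoluteGaloisGroup.toAlgEquiv (v.adicCompletion K)).symm
        (σ₂.liftNormal (AlgebraicClosure (v.adicCompletion K))))⁻¹ *
        (absoluteGaloisGroup.toAlgEquiv (v.adicCompletion K)).symm
          (σ₁.liftNormal (AlgebraicClosure (v.adicCompletion K)))) • absClosureEmbedding K (v.adicCompletion K) y =
        absClosureEmbedding K (v.adicCompletion K) y := by
      intro y hy
      have h1 := toAlgEquiv_symm_liftNormal_smul_coe M σ₁ ⟨absClosureEmbedding K (v.adicCompletion K) y, hιL y hy⟩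
      have h2 := toAlgEquiv_symm_liftNormal_smul_coe M σ₂ ⟨absClosureEmbedding K (v.adicCompletion K) y, hιL y hy⟩
      have h12' := congrArg (fun ρ : L ≃ₐ[K] L ↦
        absClosureEmbedding K (v.adicCompletion K) ((ρ ⟨y, hy⟩ : L) : AlgebraicClosure K)) h12
      simp only [hr] at h12'
      rw [mul_smul, h1, h12', ← h2, inv_smul_smul]
    have hτ := hinj _ hτ₀ hτfix
    ext z
    have hz := (IntermediateField.mem_fixingSubgroup_iff _ _).mp hτ (z : AlgebraicClosure (v.adicCompletion K)) z.2
    change (((absoluteGaloisGroup.toAlgEquiv (v.adicCompletion K)).symm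
        (σ₂.liftNormal (AlgebraicClosure (v.adicCompletion K))))⁻¹ *
        (absoluteGaloisGroup.toAlgEquiv (v.adicCompletion K)).symm
          (σ₁.liftNormal (AlgebraicClosure (v.adicCompletion K)))) • (z : AlgebraicClosure (v.adicCompletion K)) = z at hz
    rw [mul_smul, inv_smul_eq_iff, toAlgEquiv_symm_liftNormal_smul_coe, toAlgEquiv_symm_liftNormal_smul_coe] at hz
    exact hz
  · -- surjectivity: restrict the supplied `τ` to `M`
    rw [Finset.mem_filter] at hρ
    have hρ' : ∀ y : L, (y : AlgebraicClosure K) ∈ L₀ → ((ρ y : L) : AlgebraicClosure K) = y := by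
      intro y hy
      have e1 : y = IntermediateField.inclusion hL ⟨y, hy⟩ := Subtype.ext rfl
      rw [e1, hρ.2, IntermediateField.coe_inclusion]
    obtain ⟨τ, hτρ, hτM₀⟩ := hsurj ρ hρ'
    refine ⟨AlgEquiv.restrictNormalHom M (absoluteGaloisGroup.toAlgEquiv (v.adicCompletion K) τ), ?_, ?_⟩
    · rw [Finset.mem_filter]
      refine ⟨Finset.mem_univ _, fun y ↦ Subtype.ext ?_⟩
      rw [AlgEquiv.restrictNormalHom_apply, IntermediateField.coe_inclusion]
      exact (IntermediateField.mem_fixingSubgroup_iff _ _).mp hτM₀ _ y.2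
    · refine AlgEquiv.ext fun y ↦ Subtype.ext ((absClosureEmbedding K (v.adicCompletion K)).injective ?_)
      have h : absClosureEmbedding K (v.adicCompletion K) ((absRestrictNormalHom L (absGaloisRestrict K (v.adicCompletion K)
          ((absoluteGaloisGroup.toAlgEquiv (v.adicCompletion K)).symm
            ((AlgEquiv.restrictNormalHom M (absoluteGaloisGroup.toAlgEquiv (v.adicCompletion K) τ)).liftNormal
              (AlgebraicClosure (v.adicCompletion K))))) y : L) : AlgebraicClosure K) =
          absClosureEmbedding K (v.adicCompletion K) ((ρ y : L) : AlgebraicClosure K) := by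
        rw [hr, AlgEquiv.restrictNormalHom_apply, ← hτρ, coe_absRestrictNormalHom_apply₁₁, absGaloisRestrict_apply_smul]
        rfl
      exact h

/-! ### §2. THE NORM COMPATIBILITY for the ray class tower and the local Lubin–Tate tower -/

variable [IsTotallyComplex K]

open ValuativeRel in
/-- ★★ **THE NORM COMPATIBILITY `ι(N_{K(𝔪v^{m+1})/K(𝔪v^{n+1})} x) = N_{E·K_π^{m+1}/E·K_π^{n+1}}(ι x)`** (`n ≤ m`,
`x ∈ K(𝔪v^{m+1})`; both norms are Mathlib's `Algebra.norm` for the tower algebra of the inclusion, `towerAlgebra`):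
the restriction `σ ↦ (res σ̃)|_{K(𝔪v^{m+1})}` is a BIJECTION `Gal(E·K_π^{m+1}/E·K_π^{n+1}) → Gal(K(𝔪v^{m+1})/K(𝔪v^{n+1}))`
(injective by (INJ), onto by (SURJ) of `RayClassFieldLocalTowerDisjoint` — de Shalit II.1.10: `K(𝔣𝔭^{m+1})_𝔓 = Φ·k_ξ^{m+1}`, `𝔓` totally ramified in the
`𝔭`-division tower) and both norms are the products over these groups (`algebraMap_towerNorm_eq_prod`).  This is the
statement that the semi-local norm maps of de Shalit III.1.2 (2) / II.4.5 restrict, on each `𝔓`-component, the global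
norms of the ray class tower: a norm-coherent sequence of global units `(x_m ∈ K(𝔪v^{m+1}))_m` gives, under `ι`, a
norm-coherent sequence along `E·K_π^{m+1}` (`RelNormCoherentUnits hπ E`).
[cite: deShalit1987, II.1.10 Lemma and Corollary (p. 39), II.4.5 (p. 58), III.1.2 (2) (p. 101)]
[cite: NeukirchANT1999, Ch. VI §5 Prop. (5.6)] -/
theorem absClosureEmbedding_towerNorm_rayClassField_mul_pow_eq (h𝔪 : 𝔪 ≠ ⊥) (hv : ¬ 𝔪 ≤ v.asIdeal)
    (hw : ∀ u : (𝓞 K)ˣ, (u : 𝓞 K) - 1 ∈ 𝔪 → u = 1)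
    {π : 𝒪[v.adicCompletion K]} (hπ : (valuation (v.adicCompletion K)).IsUniformizer (π : v.adicCompletion K))
    {α : 𝓞 K} (hα0 : α ≠ 0) (hα𝔪 : α - 1 ∈ 𝔪) (hαw : ∀ w : HeightOneSpectrum (𝓞 K), w ≠ v → α ∉ w.asIdeal)
    {f : ℕ} (hαπ : ((α : K) : v.adicCompletion K) = (π : v.adicCompletion K) ^ f)
    (E : IntermediateField (v.adicCompletion K) (AlgebraicClosure (v.adicCompletion K)))
    [FiniteDimensional (v.adicCompletion K) E] [IsGalois (v.adicCompletion K) E]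
    (hE : E ≤ maxUnramified (v.adicCompletion K))
    (hdegE : ∀ w : WeilGroup (v.adicCompletion K),
      WeilGroup.toAbsGalois (v.adicCompletion K) w ∈ E.fixingSubgroup → (f : ℤ) ∣ WeilGroup.deg w)
    {n m : ℕ} (hnm : n ≤ m) (x : rayClassField K (𝔪 * v.asIdeal ^ (m + 1))) :
    absClosureEmbedding K (v.adicCompletion K)
        ((@Algebra.norm (rayClassField K (𝔪 * v.asIdeal ^ (n + 1))) (rayClassField K (𝔪 * v.asIdeal ^ (m + 1))) _ _
            (towerAlgebra (rayClassField_mul_pow_succ_mono h𝔪 v hnm)) x :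
          rayClassField K (𝔪 * v.asIdeal ^ (n + 1))) : AlgebraicClosure K) =
      ((@Algebra.norm (E ⊔ ltField π n : IntermediateField (v.adicCompletion K) (AlgebraicClosure (v.adicCompletion K)))
            (E ⊔ ltField π m : IntermediateField (v.adicCompletion K) (AlgebraicClosure (v.adicCompletion K))) _ _
            (towerAlgebra (sup_le_sup_left (ltField_mono hπ hnm) E))
            ⟨absClosureEmbedding K (v.adicCompletion K) x,
              absClosureEmbedding_mem_sup_ltField_of_mem_rayClassField_mul_pow h𝔪 hv hπ hα0 hα𝔪 hαw hαπ E hdegE m x.2⟩ :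
          (E ⊔ ltField π n : IntermediateField (v.adicCompletion K) (AlgebraicClosure (v.adicCompletion K)))) :
        AlgebraicClosure (v.adicCompletion K)) := by
  haveI : FiniteDimensional (v.adicCompletion K)
      (E ⊔ ltField π m : IntermediateField (v.adicCompletion K) (AlgebraicClosure (v.adicCompletion K))) :=
    IntermediateField.finiteDimensional_sup E (ltField π m)
  haveI : IsGalois (v.adicCompletion K)
      (E ⊔ ltField π m : IntermediateField (v.adicCompletion K) (AlgebraicClosure (v.adicCompletion K))) :=
    isGalois_sup_ltField hπ E m
  refine absClosureEmbedding_towerNorm_eq_towerNorm (rayClassField K (𝔪 * v.asIdeal ^ (n + 1)))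
    (rayClassField K (𝔪 * v.asIdeal ^ (m + 1))) (rayClassField_mul_pow_succ_mono h𝔪 v hnm)
    (E ⊔ ltField π n) (E ⊔ ltField π m) (sup_le_sup_left (ltField_mono hπ hnm) E)
    (fun y hy ↦ absClosureEmbedding_mem_sup_ltField_of_mem_rayClassField_mul_pow h𝔪 hv hπ hα0 hα𝔪 hαw hαπ E hdegE m hy)
    (fun y hy ↦ absClosureEmbedding_mem_sup_ltField_of_mem_rayClassField_mul_pow h𝔪 hv hπ hα0 hα𝔪 hαw hαπ E hdegE n hy)
    (fun τ hτ₀ hτfix ↦ ?_) (fun ρ hρ ↦ ?_) x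
  · -- (INJ): `RayClassFieldLocalTowerDisjoint` §2 with `E ≤ E ⊔ K_π^{n+1}`
    exact mem_fixingSubgroup_sup_ltField_of_forall_smul_absClosureEmbedding_eq h𝔪 hv hw hπ hα0 hα𝔪 hαw hαπ E hdegE m
      (IntermediateField.fixingSubgroup_antitone le_sup_left hτ₀) hτfix
  · -- (SURJ): `RayClassFieldLocalTowerDisjoint` §3
    obtain ⟨w, -, hwρ, hwM₀⟩ := exists_mem_inertia_absRestrictNormalHom_eq h𝔪 hv hw hπ hα0 hα𝔪 hαw hαπ hE hnm ρ hρ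
    exact ⟨WeilGroup.toAbsGalois (v.adicCompletion K) w, hwρ, hwM₀⟩

end Literature.NumberTheory.NumberFields

end
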